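/-
Copyright (c) 2026 the pub-hodgecm-mathlib formalisation cell (harness21).  Prover seat hodgecm-mathlib-LH10-p01 (g12): road M6 → F5 → dyadic chain of `stub_DyUnramCore` (D-UNR),
brick (L2-2)-dy «THE LEVEL-TWO FINITE ROOT, 2-FREE» — nilpotent `Ad U₃(𝔽_q)`-orbits by rank for EVERY `q`, without the Cayley map; 2026-09-03.
-/
import Literature.GroupTheory.SpecificGroups.FiniteUnitaryThreeUnipotentJordanClassesAnyChar   -- ★ (this seat): `exists_add_frob_eq_one`; brings ★ `FiniteUnitaryThreeUnipotentJordanClasses` (§1 rank dictionary, `exists_norm_eq_of_frob`, `exists_formCongr_antidiag_eq`), ★ `UnitaryThreeUnipotentConjugacy` (isotropic transitivity), ★ part 1 §1 (additive Hilbert 90 from `θ`)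
import Literature.LinearAlgebra.Matrix.UnitaryFormAdjointCayley                                 -- ★ the form adjoint `θ_J X = J⁻¹ σ(X)ᵀ J`: `formAdjoint_mul`, `formAdjoint_coe_eq_coe_inv`
import HarnessLib

/-!
# Nilpotent `Ad U₃(𝔽_q)`-orbits in `Lie U₃(𝔽_q)` are classified by the rank — EVERY `q` (the characteristic-free proof, by isotropic kernel vectors and Borel normal forms)

Topic `Literature/GroupTheory/SpecificGroups`; namespace `Literature.GroupTheory.SpecificGroups`.  THEOREMS ONLY (no definition, no named fact, no instance, no notation, no `sorry`);
kernel lane `--supports stmt-HodgeConjecture-24833`.  Cell `pub/hodgecm-mathlib` (D-0151), crux H413 = `stmt-HodgeConjecture-24833`; road M6 → F5 → the dyadic chain of organ (D-UNR)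
`stub_DyUnramCore`, LEVEL TWO, site (L2-2) ★ `interiorStrataConstancy_of_levelTwo` (`LevelTwoInteriorStrataConstancy` :264), whose ONLY use of `2 ∈ 𝒪_w^×` is `(2 : 𝓀_w) ≠ 0` fed
to ★ `exists_unitary_conj_eq_of_pow_three_eq_zero_of_rank_eq … h2` (`FiniteUnitaryThreeNilpotentOrbits`).  THAT proof transports the GROUP statement through the truncated Cayley map
`W(N) = 1 − 2N + 2N²`, injective only for `2 ≠ 0` (in characteristic `2`, `W ≡ 1`).  THIS file proves the same statement for EVERY `q` by the Lie-algebra twin of ★ p08's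
group argument ([Rogawski1990, §3.9]): for `N ∈ Lie U(σ, J₀) = {N : J₀⁻¹ σ(N)ᵀ J₀ = −N}` with `N³ = 0`, `N ≠ 0`, the vector `v := N²w` (if `N² ≠ 0`) or `v := Nw` is non-zero,
ISOTROPIC (adjoint identity `B₀(Nx, y) = −B₀(x, Ny)`) and killed by `N`; ★ `exists_mem_unitaryGroupOfForm_mulVec_single_eq` (`U(σ, J₀)` transitive on isotropic vectors) puts
`v = e₀`, and then the Lie relations + nilpotency force the STRICTLY UPPER form `n(b, c) = (0, b, c; 0, 0, −σb; 0, 0, 0)`, `c + σc = 0`.  RANK 2 ⇔ `b ≠ 0`: `Ad u(x, y)` moves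
`c ↦ c − xσb + bσx = c + bσb·(σz − z)` (`x = bz`) — killed by the additive Hilbert 90 of part 1 (`θ + σθ = 1`), and the torus `d(b⁻¹)` makes `b = 1`: ONE regular nilpotent orbit
`n(1, 0)`.  RANK 1 ⇔ `b = 0`, `c ≠ 0` skew: `Ad d(z)` scales `c ↦ zσz·c` and `c′∕c` is `σ`-fixed, hence a norm when every non-zero fixed element is one (`𝔽_{q²}`: ★ `exists_norm_eq_of_frob`):
ONE orbit.  Transport to any non-degenerate hermitian `J` along `σ(T)ᵀ J₀ T = J` (★ `exists_formCongr_antidiag_eq`; `N ↦ T N T⁻¹` maps `Lie U(J)` to `Lie U(J₀)`).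
HONEST LABEL: HC_CM is proved only modulo the 7 printed citations (2 remaining named inputs: hLiu418 = stmt-HodgeConjecture-24832, h413 = stmt-HodgeConjecture-24833) until rung 0
closes; elementary (sesqui)linear algebra, count-neutral (zero label movement until the desk prices the `stub_N6nsDyadic` rider).

* §1 (split form, any field) `antidiagonal_three_over_eq`, `antidiagonal_three_over_inv_eq_self`, `lie_entries` (the nine relations `σ(N_{2−j,2−i}) = −N_{ij}`), `B₀_mulVec_left_of_lie`;
* §2 `exists_isotropic_mulVec_eq_zero_of_lie`; §3 `lie_conj_of_mem` (`Ad U` preserves `Lie U`), **`exists_conj_eq_strictUpper_of_lie`**;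
* §4 `exists_conj_eq_regularNilpotent_of_lie` (`θ + σθ = 1`), **`exists_unitary_conj_eq_of_lie_antidiag`** (split form; `θ` + norm surjectivity);
* sequel `FiniteUnitaryThreeNilpotentOrbitsAnyCharHermitian`: transport to any non-degenerate hermitian `J` and the `𝔽_{q²}` statement
  `exists_unitary_conj_eq_of_pow_three_eq_zero_of_rank_eq_anyChar` (= ★'s with `(h2 : (2 : k) ≠ 0)` DELETED).

## References
* [Rogawski1990] J. D. Rogawski, *Automorphic Representations of Unitary Groups in Three Variables*, Ann. of Math. Stud. 123 (1990): §3.9 p. 32, Proposition 3.9.1; §1.10 p. 9.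
* [Wilson2009] R. A. Wilson, *The Finite Simple Groups*, GTM 251 (2009): §3.6.1 p. 67 (isotropic vectors, unitary transvections).
* [SerreLocalFields1979] J.-P. Serre, *Local Fields*, GTM 67 (1979): Ch. X §1 (additive Hilbert 90).
-/

set_option autoImplicit false

noncomputable section

open Matrix Module Literature.FieldTheory.FiniteFields Literature.NumberTheory.Automorphic
open Literature.NumberTheory.Automorphic.HermitianLattice Literature.NumberTheory.Automorphic.UnitaryGroup Literature.LinearAlgebra.Matrix

namespace Literature.GroupTheory.SpecificGroups

section SplitForm

variable {K : Type*} [Field K] (σ : K →+* K)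

/-! ### §1 The split form `J₀ = antidiag(1,1,1)` on `K³` and the Lie condition in coordinates -/

/-- `J₀ = (0,0,1; 0,1,0; 1,0,0)`. [cite: Rogawski1990, §1.10 p. 9] -/
private theorem antidiagonal_three_over_eq : (StdForm.antidiagonal 3).over K = !![(0 : K), 0, 1; 0, 1, 0; 1, 0, 0] := by
  have hJ : ∀ i j : Fin 3, (StdForm.antidiagonal 3).over K i j = if j = Fin.rev i then (1 : K) else 0 := by
    intro i j
    simp only [StdForm.over, Matrix.map_apply, StdForm.antidiagonal_J_apply]
    split_ifs <;> simp
  ext i j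
  rw [hJ]
  fin_cases i <;> fin_cases j <;> simp [Fin.ext_iff]

/-- `J₀² = 1`. [cite: Rogawski1990, §1.10 p. 9] -/
private theorem antidiagonal_three_over_mul_self : (StdForm.antidiagonal 3).over K * (StdForm.antidiagonal 3).over K = 1 := by
  rw [antidiagonal_three_over_eq]
  ext i j
  fin_cases i <;> fin_cases j <;> simp [Matrix.mul_apply, Fin.sum_univ_three]

/-- `J₀⁻¹ = J₀`. [cite: Rogawski1990, §1.10 p. 9] -/
private theorem antidiagonal_three_over_inv_eq_self : ((StdForm.antidiagonal 3).over K)⁻¹ = (StdForm.antidiagonal 3).over K :=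
  Matrix.inv_eq_right_inv antidiagonal_three_over_mul_self

/-- `det J₀` is a unit. [cite: Rogawski1990, §1.10 p. 9] -/
private theorem antidiagonal_three_over_det_isUnit : IsUnit ((StdForm.antidiagonal 3).over K).det :=
  (Matrix.isUnit_iff_isUnit_det _).1 ((StdForm.antidiagonal 3).isUnit_over K)

/-- **The Lie condition `J₀⁻¹ σ(N)ᵀ J₀ = −N` in coordinates**: `σ(N_{2−j, 2−i}) = −N_{i j}` for the nine pairs `(i, j)`. [cite: Rogawski1990, §1.10 p. 9] -/
theorem lie_entries {N : Matrix (Fin 3) (Fin 3) K} (hN : ((StdForm.antidiagonal 3).over K)⁻¹ * (N.map σ)ᵀ * (StdForm.antidiagonal 3).over K = -N) :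
    σ (N 2 2) = -N 0 0 ∧ σ (N 1 2) = -N 0 1 ∧ σ (N 0 2) = -N 0 2 ∧ σ (N 2 1) = -N 1 0 ∧ σ (N 1 1) = -N 1 1 ∧ σ (N 0 1) = -N 1 2 ∧
      σ (N 2 0) = -N 2 0 ∧ σ (N 1 0) = -N 2 1 ∧ σ (N 0 0) = -N 2 2 := by
  rw [antidiagonal_three_over_inv_eq_self] at hN
  have e : ∀ i j : Fin 3, (StdForm.antidiagonal 3).over K i j = (!![(0 : K), 0, 1; 0, 1, 0; 1, 0, 0] : Matrix (Fin 3) (Fin 3) K) i j := fun i j => by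
    rw [antidiagonal_three_over_eq]
  have h := fun i j => congrFun (congrFun hN i) j
  simp only [Matrix.mul_apply, Fin.sum_univ_three, e, Matrix.transpose_apply, Matrix.map_apply, Matrix.neg_apply] at h
  refine ⟨?_, ?_, ?_, ?_, ?_, ?_, ?_, ?_, ?_⟩
  · simpa using h 0 0
  · simpa using h 0 1
  · simpa using h 0 2
  · simpa using h 1 0
  · simpa using h 1 1
  · simpa using h 1 2
  · simpa using h 2 0
  · simpa using h 2 1
  · simpa using h 2 2

/-- **The adjoint identity of the Lie algebra**: `B₀(Nx, y) = −B₀(x, Ny)` for `N ∈ Lie U(σ, J₀)` (the infinitesimal form of ★ `B₀_sub_one_mulVec_mulVec`).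
[cite: Rogawski1990, §3.9 p. 32] -/
theorem B₀_mulVec_left_of_lie {N : Matrix (Fin 3) (Fin 3) K} (hN : ((StdForm.antidiagonal 3).over K)⁻¹ * (N.map σ)ᵀ * (StdForm.antidiagonal 3).over K = -N)
    (x y : Fin 3 → K) : B₀ σ 3 (N *ᵥ x) y = -B₀ σ 3 x (N *ᵥ y) := by
  obtain ⟨h22, h12, h02, h21, h11, h01, h20, h10, h00⟩ := lie_entries σ hN
  simp only [B₀_three_apply, mulVec_three_apply, map_add, map_mul, h22, h12, h02, h21, h11, h01, h20, h10, h00]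
  ring

/-! ### §2 A non-zero cube-zero element of `Lie U(σ, J₀)` kills a non-zero isotropic vector -/

/-- **`N ∈ Lie U(σ, J₀)`, `N³ = 0`, `N ≠ 0` ⇒ some `v ≠ 0` has `B₀(v, v) = 0` and `Nv = 0`**: `v = Nw` if `N² = 0` (`B₀(Nw, Nw) = −B₀(w, N²w) = 0`), else `v = N²w`
(`B₀(N(Nw), N²w) = −B₀(Nw, N³w) = 0`). [cite: Rogawski1990, §3.9 p. 32] -/
theorem exists_isotropic_mulVec_eq_zero_of_lie {N : Matrix (Fin 3) (Fin 3) K}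
    (hN : ((StdForm.antidiagonal 3).over K)⁻¹ * (N.map σ)ᵀ * (StdForm.antidiagonal 3).over K = -N) (h3 : N * N * N = 0) (h0 : N ≠ 0) :
    ∃ v : Fin 3 → K, v ≠ 0 ∧ N *ᵥ v = 0 ∧ B₀ σ 3 v v = 0 := by
  have hex : ∀ {M : Matrix (Fin 3) (Fin 3) K}, M ≠ 0 → ∃ w : Fin 3 → K, M *ᵥ w ≠ 0 := by
    intro M hM
    by_contra h
    apply hM
    apply Matrix.toLin'.injective
    refine LinearMap.ext fun w' => ?_
    rw [Matrix.toLin'_apply, Matrix.toLin'_apply, not_not.1 (not_exists.1 h w'), Matrix.zero_mulVec]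
  by_cases hsq : N * N = 0
  · obtain ⟨w, hw⟩ := hex h0
    refine ⟨N *ᵥ w, hw, ?_, ?_⟩
    · rw [Matrix.mulVec_mulVec, hsq, Matrix.zero_mulVec]
    · rw [B₀_mulVec_left_of_lie σ hN, Matrix.mulVec_mulVec, hsq, Matrix.zero_mulVec, map_zero, neg_zero]
  · obtain ⟨w, hw⟩ := hex hsq
    refine ⟨(N * N) *ᵥ w, hw, ?_, ?_⟩
    · rw [Matrix.mulVec_mulVec, ← Matrix.mul_assoc, h3, Matrix.zero_mulVec]
    · have e : (N * N) *ᵥ w = N *ᵥ (N *ᵥ w) := by rw [Matrix.mulVec_mulVec]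
      rw [e, B₀_mulVec_left_of_lie σ hN, Matrix.mulVec_mulVec, Matrix.mulVec_mulVec, h3, Matrix.zero_mulVec, map_zero, neg_zero]

/-! ### §3 Conjugation into the strictly upper triangular normal form `n(b, c)` -/

/-- **`Ad U(σ, J₀)` preserves `Lie U(σ, J₀)`**: `θ(k⁻¹ N k) = θ(k)·θ(N)·θ(k⁻¹) = k⁻¹·(−N)·k`. [cite: Rogawski1990, §3.9 p. 32] -/
theorem lie_conj_of_mem {N : Matrix (Fin 3) (Fin 3) K} (hN : ((StdForm.antidiagonal 3).over K)⁻¹ * (N.map σ)ᵀ * (StdForm.antidiagonal 3).over K = -N)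
    {k : GL (Fin 3) K} (hk : k ∈ unitaryGroupOfForm σ ((StdForm.antidiagonal 3).over K)) :
    ((StdForm.antidiagonal 3).over K)⁻¹ * (((k : Matrix (Fin 3) (Fin 3) K) * N * ((k⁻¹ : GL (Fin 3) K) : Matrix (Fin 3) (Fin 3) K)).map σ)ᵀ *
        (StdForm.antidiagonal 3).over K =
      -((k : Matrix (Fin 3) (Fin 3) K) * N * ((k⁻¹ : GL (Fin 3) K) : Matrix (Fin 3) (Fin 3) K)) := by
  have hJu := antidiagonal_three_over_det_isUnit (K := K)
  rw [formAdjoint_mul σ hJu, formAdjoint_mul σ hJu, formAdjoint_coe_eq_coe_inv σ hJu hk, formAdjoint_coe_eq_coe_inv σ hJu (inv_mem hk), inv_inv, hN]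
  simp only [Matrix.mul_neg, Matrix.neg_mul, Matrix.mul_assoc]

/-- `(M e₀)_i = M_{i0}`. [cite: Rogawski1990, §1.10 p. 9] -/
private theorem mulVec_single_zero_apply (M : Matrix (Fin 3) (Fin 3) K) (i : Fin 3) : (M *ᵥ Pi.single 0 1) i = M i 0 := by
  rw [mulVec_three_apply]; simp

/-- **EVERY NON-ZERO CUBE-ZERO `N ∈ Lie U(σ, J₀)` IS `Ad U(σ, J₀)`-CONJUGATE TO A STRICTLY UPPER `n(b, c) = (0, b, c; 0, 0, −σb; 0, 0, 0)` with `c + σc = 0`** (`σ` an involution):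
§2 gives an isotropic `v ≠ 0` with `Nv = 0`; ★ transitivity gives `k₀ ∈ U` with `k₀e₀ = v`; `M = k₀⁻¹Nk₀ ∈ Lie U` has `Me₀ = 0`, so its first column and (Lie relations) last row
vanish, `M₁₁` is skew and, `M` being block-triangular cube-zero, `M₁₁³ = 0`; the remaining relations give `M₁₂ = −σM₀₁`, `M₀₂ + σM₀₂ = 0`. [cite: Rogawski1990, §3.9 p. 32] -/
theorem exists_conj_eq_strictUpper_of_lie (hσ : ∀ z : K, σ (σ z) = z) {N : Matrix (Fin 3) (Fin 3) K}
    (hN : ((StdForm.antidiagonal 3).over K)⁻¹ * (N.map σ)ᵀ * (StdForm.antidiagonal 3).over K = -N) (h3 : N * N * N = 0) (h0 : N ≠ 0) :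
    ∃ k : GL (Fin 3) K, k ∈ unitaryGroupOfForm σ ((StdForm.antidiagonal 3).over K) ∧ ∃ b c : K,
      (k : Matrix (Fin 3) (Fin 3) K) * N * ((k⁻¹ : GL (Fin 3) K) : Matrix (Fin 3) (Fin 3) K) = !![0, b, c; 0, 0, -σ b; 0, 0, 0] ∧ c + σ c = 0 := by
  obtain ⟨v, hv0, hNv, hiso⟩ := exists_isotropic_mulVec_eq_zero_of_lie σ hN h3 h0
  obtain ⟨k₀, hk₀, hk₀v⟩ := exists_mem_unitaryGroupOfForm_mulVec_single_eq σ hσ hv0 hiso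
  -- `M := k₀⁻¹ N k₀`
  set M : Matrix (Fin 3) (Fin 3) K := ((k₀⁻¹ : GL (Fin 3) K) : Matrix (Fin 3) (Fin 3) K) * N * (k₀ : Matrix (Fin 3) (Fin 3) K) with hM
  have hMlie : ((StdForm.antidiagonal 3).over K)⁻¹ * (M.map σ)ᵀ * (StdForm.antidiagonal 3).over K = -M := by
    have h := lie_conj_of_mem σ hN (inv_mem hk₀)
    rw [inv_inv] at h
    exact h
  have hMe : M *ᵥ Pi.single 0 1 = 0 := by
    rw [hM, ← Matrix.mulVec_mulVec, ← Matrix.mulVec_mulVec, hk₀v, hNv, Matrix.mulVec_zero]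
  have h3M : M * M * M = 0 := by
    have e : M * M * M = ((k₀⁻¹ : GL (Fin 3) K) : Matrix (Fin 3) (Fin 3) K) * (N * N * N) * (k₀ : Matrix (Fin 3) (Fin 3) K) := by
      simp only [hM, Matrix.mul_assoc, Units.mul_inv_cancel_left]
    rw [e, h3, Matrix.mul_zero, Matrix.zero_mul]
  -- the entries of `M`
  have hc0 : ∀ i, M i 0 = 0 := fun i => by rw [← mulVec_single_zero_apply M i, hMe]; rfl
  obtain ⟨m22, m12, m02, m21, m11, m01, m20, m10, m00⟩ := lie_entries σ hMlie
  have hM00 : M 0 0 = 0 := hc0 0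
  have hM10 : M 1 0 = 0 := hc0 1
  have hM20 : M 2 0 = 0 := hc0 2
  have hM21 : M 2 1 = 0 := by rw [← hσ (M 2 1), m21, hM10, neg_zero, map_zero]
  have hM22 : M 2 2 = 0 := by rw [← hσ (M 2 2), m22, hM00, neg_zero, map_zero]
  have hM11 : M 1 1 = 0 := by
    have h := congrFun (congrFun h3M 1) 1
    simp only [Matrix.mul_apply, Fin.sum_univ_three, hM10, hM20, hM21, Matrix.zero_apply] at h
    have h' : M 1 1 * M 1 1 * M 1 1 = 0 := by linear_combination h
    rcases mul_eq_zero.1 h' with h1 | h1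
    · rcases mul_eq_zero.1 h1 with h2 | h2 <;> exact h2
    · exact h1
  have hM12 : M 1 2 = -σ (M 0 1) := by rw [← hσ (M 1 2), m12, map_neg]
  have hskew : M 0 2 + σ (M 0 2) = 0 := by rw [m02]; ring
  refine ⟨k₀⁻¹, inv_mem hk₀, M 0 1, M 0 2, ?_, hskew⟩
  rw [inv_inv]
  change M = _
  ext i j
  fin_cases i <;> fin_cases j <;> simp [hM00, hM10, hM20, hM21, hM22, hM11, hM12]

/-! ### §4 The two non-zero orbits: regular (`rank 2`) via `θ`, rank `1` via norms -/

/-- **`Ad` of `u(x, y, w) = (1, x, y; 0, 1, w; 0, 0, 1)` on a strictly upper `(0, a, b; 0, 0, c; 0, 0, 0)` moves only the corner: `b ↦ b + xc − aw`**.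
[cite: Rogawski1990, §3.9 p. 32] -/
theorem coe_upperTriangularUnipotent_conj_strictUpper {x y w a b c : K} {n : GL (Fin 3) K} (hn : (n : Matrix (Fin 3) (Fin 3) K) = !![1, x, y; 0, 1, w; 0, 0, 1])
    (hn' : ((n⁻¹ : GL (Fin 3) K) : Matrix (Fin 3) (Fin 3) K) = !![1, -x, x * w - y; 0, 1, -w; 0, 0, 1]) :
    (n : Matrix (Fin 3) (Fin 3) K) * !![0, a, b; 0, 0, c; 0, 0, 0] * ((n⁻¹ : GL (Fin 3) K) : Matrix (Fin 3) (Fin 3) K) = !![0, a, b + x * c - a * w; 0, 0, c; 0, 0, 0] := by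
  rw [hn, hn']
  ext i j
  fin_cases i <;> fin_cases j <;> (simp [Matrix.mul_apply, Fin.sum_univ_three]; try ring)

/-- **`Ad` of the torus `d(z) = diag(z, 1, (σz)⁻¹)` scales a strictly upper matrix: `(a, b, c) ↦ (za, zσz·b, σz·c)`**. [cite: Rogawski1990, §3.9 p. 32] -/
theorem coe_torusElt_conj_strictUpper {z a b c : K} {d : GL (Fin 3) K}
    (hd : (d : Matrix (Fin 3) (Fin 3) K) = Matrix.diagonal ![z, 1, (σ z)⁻¹])
    (hd' : ((d⁻¹ : GL (Fin 3) K) : Matrix (Fin 3) (Fin 3) K) = Matrix.diagonal ![z⁻¹, 1, σ z]) :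
    (d : Matrix (Fin 3) (Fin 3) K) * !![0, a, b; 0, 0, c; 0, 0, 0] * ((d⁻¹ : GL (Fin 3) K) : Matrix (Fin 3) (Fin 3) K) = !![0, z * a, z * σ z * b; 0, 0, σ z * c; 0, 0, 0] := by
  rw [hd, hd']
  ext i j
  fin_cases i <;> fin_cases j <;> (simp [Matrix.mul_apply, Matrix.diagonal]; try ring)

/-- `k M k⁻¹ = 0 ↔ M = 0` in the matrix spelling of this file. [cite: Rogawski1990, §3.9 p. 32] -/
private theorem coe_mul_mul_coe_inv_eq_zero_iff' (k : GL (Fin 3) K) (M : Matrix (Fin 3) (Fin 3) K) :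
    (k : Matrix (Fin 3) (Fin 3) K) * M * ((k⁻¹ : GL (Fin 3) K) : Matrix (Fin 3) (Fin 3) K) = 0 ↔ M = 0 := by
  constructor
  · intro h
    have h' := congrArg (fun X => ((k⁻¹ : GL (Fin 3) K) : Matrix (Fin 3) (Fin 3) K) * X * (k : Matrix (Fin 3) (Fin 3) K)) h
    simpa only [Matrix.mul_assoc, Units.inv_mul_cancel_left, Matrix.mul_zero, Matrix.zero_mul, Units.inv_mul, Matrix.mul_one] using h'
  · rintro rfl; rw [Matrix.mul_zero, Matrix.zero_mul]

/-- **THE REGULAR NILPOTENT NORMAL FORM** (`θ + σθ = 1`): a cube-zero `N ∈ Lie U(σ, J₀)` with `N² ≠ 0` is `Ad U(σ, J₀)`-conjugate to `n(1, 0) = (0, 1, 0; 0, 0, −1; 0, 0, 0)`.  From §3's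
`n(b, c)` (`b ≠ 0` since `N² ≠ 0`): `Ad u(bz, y)` with `σz − z = −c∕(bσb)` (additive Hilbert 90 from `θ`) and `y + σy = −xσx` kills `c`; `Ad d(b⁻¹)` makes `b = 1`.
[cite: Rogawski1990, §3.9 p. 32, Prop. 3.9.1] [cite: SerreLocalFields1979, Ch. X §1] -/
theorem exists_conj_eq_regularNilpotent_of_lie (hσ : ∀ z : K, σ (σ z) = z) {θ : K} (hθ : θ + σ θ = 1) {N : Matrix (Fin 3) (Fin 3) K}
    (hN : ((StdForm.antidiagonal 3).over K)⁻¹ * (N.map σ)ᵀ * (StdForm.antidiagonal 3).over K = -N) (h3 : N * N * N = 0) (hsq : N * N ≠ 0) :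
    ∃ k : GL (Fin 3) K, k ∈ unitaryGroupOfForm σ ((StdForm.antidiagonal 3).over K) ∧
      (k : Matrix (Fin 3) (Fin 3) K) * N * ((k⁻¹ : GL (Fin 3) K) : Matrix (Fin 3) (Fin 3) K) = !![0, 1, 0; 0, 0, -1; 0, 0, 0] := by
  have h0 : N ≠ 0 := fun h => hsq (by rw [h, Matrix.mul_zero])
  obtain ⟨k₁, hk₁, b, c, hshape, hc⟩ := exists_conj_eq_strictUpper_of_lie σ hσ hN h3 h0
  -- `b ≠ 0`
  have hb : b ≠ 0 := by
    intro hb0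
    apply hsq
    rw [← coe_mul_mul_coe_inv_eq_zero_iff' k₁ (N * N)]
    have e : (k₁ : Matrix (Fin 3) (Fin 3) K) * (N * N) * ((k₁⁻¹ : GL (Fin 3) K) : Matrix (Fin 3) (Fin 3) K) =
        ((k₁ : Matrix (Fin 3) (Fin 3) K) * N * ((k₁⁻¹ : GL (Fin 3) K) : Matrix (Fin 3) (Fin 3) K)) *
          ((k₁ : Matrix (Fin 3) (Fin 3) K) * N * ((k₁⁻¹ : GL (Fin 3) K) : Matrix (Fin 3) (Fin 3) K)) := by
      simp only [Matrix.mul_assoc, Units.inv_mul_cancel_left]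
    rw [e, hshape, hb0, map_zero, neg_zero]
    ext i j
    fin_cases i <;> fin_cases j <;> simp [Matrix.mul_apply, Fin.sum_univ_three]
  have hσb : σ b ≠ 0 := (map_ne_zero σ).2 hb
  have hbσb : b * σ b ≠ 0 := mul_ne_zero hb hσb
  -- the `N`-step: `x = bz`, `σz − z = −c∕(bσb)`
  have ht : -(c / (b * σ b)) + σ (-(c / (b * σ b))) = 0 := by
    have hσc : σ c = -c := by linear_combination hc
    rw [map_neg, map_div₀, map_mul, hσ, hσc]
    field_simp
    ring
  obtain ⟨z, hz⟩ := exists_map_sub_eq_of_add_map_eq_zero σ hθ ht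
  obtain ⟨x, hx⟩ : ∃ x : K, x = b * z := ⟨_, rfl⟩
  have hfix : σ (-(x * σ x)) = -(x * σ x) := by rw [map_neg, map_mul, hσ, mul_comm]
  obtain ⟨y, hy⟩ := exists_add_map_eq_of_map_eq_self σ hθ hfix
  obtain ⟨n, hn, hn'⟩ := exists_units_coe_eq_upperTriangularUnipotent x y (-σ x)
  have hnmem : n ∈ unitaryGroupOfForm σ ((StdForm.antidiagonal 3).over K) :=
    (mem_unitaryGroupOfForm_iff_of_coe_eq_upperUnipotent σ hσ hn).2 ⟨rfl, by linear_combination hy⟩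
  have hcorner : c + x * -σ b - b * -σ x = 0 := by
    rw [hx, map_mul]
    have key : b * σ b * (σ z - z) = -c := by rw [hz]; field_simp
    linear_combination key
  have hshape₂ : (n : Matrix (Fin 3) (Fin 3) K) * ((k₁ : Matrix (Fin 3) (Fin 3) K) * N * ((k₁⁻¹ : GL (Fin 3) K) : Matrix (Fin 3) (Fin 3) K)) *
      ((n⁻¹ : GL (Fin 3) K) : Matrix (Fin 3) (Fin 3) K) = !![0, b, 0; 0, 0, -σ b; 0, 0, 0] := by
    rw [hshape, coe_upperTriangularUnipotent_conj_strictUpper hn hn', hcorner]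
  -- the torus step: `d(b⁻¹)`
  obtain ⟨d, hd, hd'⟩ := exists_units_coe_eq_torusElt σ (inv_ne_zero hb)
  have hdmem := torusElt_mem_unitaryGroupOfForm σ (inv_ne_zero hb) (hσ _) hd
  have hshape₃ : (d : Matrix (Fin 3) (Fin 3) K) * ((n : Matrix (Fin 3) (Fin 3) K) * ((k₁ : Matrix (Fin 3) (Fin 3) K) * N *
      ((k₁⁻¹ : GL (Fin 3) K) : Matrix (Fin 3) (Fin 3) K)) * ((n⁻¹ : GL (Fin 3) K) : Matrix (Fin 3) (Fin 3) K)) * ((d⁻¹ : GL (Fin 3) K) : Matrix (Fin 3) (Fin 3) K) =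
      !![0, 1, 0; 0, 0, -1; 0, 0, 0] := by
    rw [hshape₂, coe_torusElt_conj_strictUpper σ hd hd', inv_mul_cancel₀ hb, mul_zero, map_inv₀, mul_neg, inv_mul_cancel₀ hσb]
  refine ⟨d * n * k₁, mul_mem (mul_mem hdmem hnmem) hk₁, ?_⟩
  rw [← hshape₃]
  simp only [Units.val_mul, _root_.mul_inv_rev, Matrix.mul_assoc]

/-- **NILPOTENT `Ad U(σ, J₀)`-ORBITS BY RANK, SPLIT FORM, EVERY CHARACTERISTIC**: over a field `K` with an involution `σ`, an element `θ` with `θ + σθ = 1`, and every non-zero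
`σ`-fixed element a norm `σz·z`, two cube-zero `N, N′ ∈ Lie U(σ, J₀)` with `rank N = rank N′` are conjugate by `U(σ, J₀)`: rank `0` — both vanish; rank `2` — both reach `n(1, 0)`;
rank `1` — §3's forms are `c•E₀₂`, `c′•E₀₂` with `c′∕c` fixed, a norm `zσz`, and `Ad d(z)` scales `c ↦ zσz·c`. [cite: Rogawski1990, §3.9 p. 32, Prop. 3.9.1] [cite: Wilson2009, §3.6.1 p. 67] -/
theorem exists_unitary_conj_eq_of_lie_antidiag (hσ : ∀ z : K, σ (σ z) = z) {θ : K} (hθ : θ + σ θ = 1)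
    (hnorm : ∀ e : K, σ e = e → e ≠ 0 → ∃ z : K, σ z * z = e)
    {N N' : Matrix (Fin 3) (Fin 3) K}
    (hN : ((StdForm.antidiagonal 3).over K)⁻¹ * (N.map σ)ᵀ * (StdForm.antidiagonal 3).over K = -N)
    (hN' : ((StdForm.antidiagonal 3).over K)⁻¹ * (N'.map σ)ᵀ * (StdForm.antidiagonal 3).over K = -N')
    (h3 : N * N * N = 0) (h3' : N' * N' * N' = 0) (hrank : N.rank = N'.rank) :
    ∃ g : GL (Fin 3) K, g ∈ unitaryGroupOfForm σ ((StdForm.antidiagonal 3).over K) ∧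
      (g : Matrix (Fin 3) (Fin 3) K) * N * ((g⁻¹ : GL (Fin 3) K) : Matrix (Fin 3) (Fin 3) K) = N' := by
  have hnil : IsNilpotent N := ⟨3, by rw [pow_succ, pow_two, h3]⟩
  have hnil' : IsNilpotent N' := ⟨3, by rw [pow_succ, pow_two, h3']⟩
  -- glue: `k N k⁻¹ = X = k′ N′ k′⁻¹ ⇒ (k′⁻¹ k) N (k′⁻¹ k)⁻¹ = N′`
  have glue : ∀ {k k' : GL (Fin 3) K} {X : Matrix (Fin 3) (Fin 3) K},
      k ∈ unitaryGroupOfForm σ ((StdForm.antidiagonal 3).over K) → k' ∈ unitaryGroupOfForm σ ((StdForm.antidiagonal 3).over K) →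
      (k : Matrix (Fin 3) (Fin 3) K) * N * ((k⁻¹ : GL (Fin 3) K) : Matrix (Fin 3) (Fin 3) K) = X →
      (k' : Matrix (Fin 3) (Fin 3) K) * N' * ((k'⁻¹ : GL (Fin 3) K) : Matrix (Fin 3) (Fin 3) K) = X →
      ∃ g : GL (Fin 3) K, g ∈ unitaryGroupOfForm σ ((StdForm.antidiagonal 3).over K) ∧
        (g : Matrix (Fin 3) (Fin 3) K) * N * ((g⁻¹ : GL (Fin 3) K) : Matrix (Fin 3) (Fin 3) K) = N' := by
    intro k k' X hk hk' hkN hkN'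
    refine ⟨k'⁻¹ * k, mul_mem (inv_mem hk') hk, ?_⟩
    have e : N' = ((k'⁻¹ : GL (Fin 3) K) : Matrix (Fin 3) (Fin 3) K) * X * (k' : Matrix (Fin 3) (Fin 3) K) := by
      rw [← hkN']; simp only [Matrix.mul_assoc, Units.inv_mul_cancel_left, Units.inv_mul, Matrix.mul_one]
    rw [e, ← hkN]
    simp only [Units.val_mul, _root_.mul_inv_rev, inv_inv, Matrix.mul_assoc]
  by_cases h0 : N = 0
  · -- rank 0
    have h0' : N' = 0 := by rw [← rank_eq_zero_iff_eq_zero, ← hrank, h0, Matrix.rank_zero]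
    refine ⟨1, Subgroup.one_mem _, ?_⟩
    rw [h0, h0', Matrix.mul_zero, Matrix.zero_mul]
  have h0' : N' ≠ 0 := by
    intro h; apply h0; rw [← rank_eq_zero_iff_eq_zero, hrank, h, Matrix.rank_zero]
  by_cases hsq : N * N = 0
  · -- rank 1
    have hr : N'.rank = 1 := by rw [← hrank]; exact rank_eq_one_of_sq_eq_zero hsq h0
    have hsq' : N' * N' = 0 := by
      by_contra hne
      have h2 := rank_eq_two_of_sq_ne_zero hnil' hne
      omega
    obtain ⟨k, hk, b, c, hkN, hc⟩ := exists_conj_eq_strictUpper_of_lie σ hσ hN h3 h0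
    obtain ⟨k', hk', b', c', hkN', hc'⟩ := exists_conj_eq_strictUpper_of_lie σ hσ hN' h3' h0'
    -- `b = 0 = b′` (the forms square to zero), `c, c′ ≠ 0`
    have hb_of : ∀ {k₁ : GL (Fin 3) K} {M : Matrix (Fin 3) (Fin 3) K} {b₁ c₁ : K}, M * M = 0 → M ≠ 0 →
        (k₁ : Matrix (Fin 3) (Fin 3) K) * M * ((k₁⁻¹ : GL (Fin 3) K) : Matrix (Fin 3) (Fin 3) K) = !![0, b₁, c₁; 0, 0, -σ b₁; 0, 0, 0] → b₁ = 0 ∧ c₁ ≠ 0 := by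
      intro k₁ M b₁ c₁ hMM hM0 hkM
      have hsq₁ : ((k₁ : Matrix (Fin 3) (Fin 3) K) * M * ((k₁⁻¹ : GL (Fin 3) K) : Matrix (Fin 3) (Fin 3) K)) *
          ((k₁ : Matrix (Fin 3) (Fin 3) K) * M * ((k₁⁻¹ : GL (Fin 3) K) : Matrix (Fin 3) (Fin 3) K)) = 0 := by
        have e : ((k₁ : Matrix (Fin 3) (Fin 3) K) * M * ((k₁⁻¹ : GL (Fin 3) K) : Matrix (Fin 3) (Fin 3) K)) *
            ((k₁ : Matrix (Fin 3) (Fin 3) K) * M * ((k₁⁻¹ : GL (Fin 3) K) : Matrix (Fin 3) (Fin 3) K)) =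
            (k₁ : Matrix (Fin 3) (Fin 3) K) * (M * M) * ((k₁⁻¹ : GL (Fin 3) K) : Matrix (Fin 3) (Fin 3) K) := by
          simp only [Matrix.mul_assoc, Units.inv_mul_cancel_left]
        rw [e, hMM, Matrix.mul_zero, Matrix.zero_mul]
      rw [hkM] at hsq₁
      have h02 : b₁ * -σ b₁ = 0 := by
        have h := congrFun (congrFun hsq₁ 0) 2
        simpa [Matrix.mul_apply, Fin.sum_univ_three] using h
      have hb₁ : b₁ = 0 := by
        rcases mul_eq_zero.1 h02 with h | h
        · exact h
        · exact (map_eq_zero σ).1 (neg_eq_zero.1 h)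
      refine ⟨hb₁, fun hc₁ => hM0 ?_⟩
      rw [← coe_mul_mul_coe_inv_eq_zero_iff' k₁ M, hkM, hb₁, hc₁, map_zero, neg_zero]
      ext i j
      fin_cases i <;> fin_cases j <;> simp
    obtain ⟨hb, hc0⟩ := hb_of hsq h0 hkN
    obtain ⟨hb', hc0'⟩ := hb_of hsq' h0' hkN'
    rw [hb, map_zero, neg_zero] at hkN
    rw [hb', map_zero, neg_zero] at hkN'
    -- `e := c′∕c` is fixed and non-zero, hence a norm `σz·z`
    have hσc : σ c = -c := by linear_combination hc
    have hσc' : σ c' = -c' := by linear_combination hc'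
    have he : σ (c' / c) = c' / c := by rw [map_div₀, hσc, hσc', neg_div_neg_eq]
    obtain ⟨z, hz⟩ := hnorm _ he (div_ne_zero hc0' hc0)
    have hz0 : z ≠ 0 := by rintro rfl; rw [map_zero, zero_mul] at hz; exact div_ne_zero hc0' hc0 hz.symm
    obtain ⟨d, hd, hd'⟩ := exists_units_coe_eq_torusElt σ hz0
    have hdmem := torusElt_mem_unitaryGroupOfForm σ hz0 (hσ _) hd
    have hdk : ((d * k : GL (Fin 3) K) : Matrix (Fin 3) (Fin 3) K) * N * (((d * k)⁻¹ : GL (Fin 3) K) : Matrix (Fin 3) (Fin 3) K) = !![0, 0, c'; 0, 0, 0; 0, 0, 0] := by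
      have e : ((d * k : GL (Fin 3) K) : Matrix (Fin 3) (Fin 3) K) * N * (((d * k)⁻¹ : GL (Fin 3) K) : Matrix (Fin 3) (Fin 3) K) =
          (d : Matrix (Fin 3) (Fin 3) K) * ((k : Matrix (Fin 3) (Fin 3) K) * N * ((k⁻¹ : GL (Fin 3) K) : Matrix (Fin 3) (Fin 3) K)) *
            ((d⁻¹ : GL (Fin 3) K) : Matrix (Fin 3) (Fin 3) K) := by
        simp only [Units.val_mul, _root_.mul_inv_rev, Matrix.mul_assoc]
      rw [e, hkN, coe_torusElt_conj_strictUpper σ hd hd', mul_zero, mul_zero]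
      have hcc : z * σ z * c = c' := by
        rw [mul_comm z, hz]; field_simp
      rw [hcc]
    exact glue (mul_mem hdmem hk) hk' hdk hkN'
  · -- rank 2
    have hr : N'.rank = 2 := by rw [← hrank]; exact rank_eq_two_of_sq_ne_zero hnil hsq
    have hsq' : N' * N' ≠ 0 := by
      intro h
      have h1 := rank_eq_one_of_sq_eq_zero h h0'
      omega
    obtain ⟨k, hk, hkN⟩ := exists_conj_eq_regularNilpotent_of_lie σ hσ hθ hN h3 hsq
    obtain ⟨k', hk', hkN'⟩ := exists_conj_eq_regularNilpotent_of_lie σ hσ hθ hN' h3' hsq'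
    exact glue hk hk' hkN hkN'

end SplitForm

end Literature.GroupTheory.SpecificGroups

end
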